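import Mathlib
import HarnessLib

/-!
# The normal push-off frame `X_w` along an axis adapted to `J` (Wendl 2020, App. B, Lemma B.32)

Flat model, dimension four. Let `Jt` be a smooth almost complex structure on an open
`V ⊆ ℂ × ℂ` which is standard on normal vectors at axis points, `Jt(q,0)(0,1) = (0,i)` for
`|q| < r` (the output of `Literature/Geometry/Symplectic/JAdaptedNormalFrameChart.lean`). The
normal frame of Wendl 2020, §B.2.3 is

  `X_w(x) = Re w • e₂ + Im w • Jt(x) e₂`,   `e₂ = (0,1)`,

a real-linear map `frame Jt x : ℂ →L[ℝ] ℂ × ℂ` in `w`, complex-linear for `Jt(x)`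
(`frame_I_mul`: `X_{iw} = Jt X_w` where `Jt² = -1`), equal to `w ↦ (0,w)` at axis points
(`frame_axis`). **Lemma B.32** (`exists_frame_estimates`): on a small closed ball about `0`,

  `‖X_w(q,p) - (0,w)‖ ≤ C |p| |w|`,   `‖∂_q X_w(q,p)‖ ≤ C |p| |w|`,

(the printed `|X̌_w(z,p)| ≤ C|p||w|`, `|X̂_w(z,p) - w| ≤ C|p||w|`, `|d₁X_w(z,p)| ≤ C|p||w|`; both
component bounds follow from the first display since `‖·.1‖, ‖·.2‖ ≤ ‖·‖`), together with the
Lipschitz bound `‖X_w(x) - X_w(x')‖ ≤ C‖x - x'‖|w|` used for the push-off map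
`Ψ(z,w) = u(z) + X_w(u(z))`. Brick B3b of the blueprint for
`Literature.Geometry.Symplectic.jHolomorphic_localBranchDichotomy`.

Everything is proved; no named facts.

## References

* C. Wendl, *Lectures on Contact 3-Manifolds, Holomorphic Curves and Intersection Theory*,
  Cambridge Tracts in Math. 220 (2020), App. B, §B.2.3, (B.16) and Lemma B.32. [Wendl2020]
* M. Micallef, B. White, *The structure of branch points in minimal surfaces and in
  pseudoholomorphic curves*, Ann. of Math. 141 (1995), §6. [MicallefWhite1995]
-/

noncomputable section

open scoped ContDiff Topology
open Set Filter Metric Function Complex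

namespace Literature.Geometry.Symplectic.NormalPushoff

variable (Jt : ℂ × ℂ → ℂ × ℂ →L[ℝ] ℂ × ℂ)

/-- The normal frame `X_w(x) = Re w • e₂ + Im w • Jt(x) e₂` as a real-linear map in `w`.
[cite: Wendl2020, App. B, §B.2.3, (B.16)] -/
def frame (x : ℂ × ℂ) : ℂ →L[ℝ] ℂ × ℂ :=
  (reCLM : ℂ →L[ℝ] ℝ).smulRight (((0 : ℂ), (1 : ℂ)) : ℂ × ℂ) +
    (imCLM : ℂ →L[ℝ] ℝ).smulRight (Jt x (0, 1))

/-- Unfolding `frame`. [folklore] -/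
theorem frame_apply (x : ℂ × ℂ) (w : ℂ) :
    frame Jt x w = w.re • (((0 : ℂ), (1 : ℂ)) : ℂ × ℂ) + w.im • Jt x (0, 1) := by
  simp [frame]

/-- At a point where `Jt x e₂ = (0, i)` the frame is the standard one: `X_w(x) = (0, w)`.
[cite: Wendl2020, App. B, proof of Lemma B.32] -/
theorem frame_axis {x : ℂ × ℂ} (hx : Jt x (0, 1) = (0, I)) (w : ℂ) : frame Jt x w = (0, w) := by
  rw [frame_apply, hx]
  ext <;> simp [real_smul, re_add_im]

/-- The frame is complex-linear for `Jt(x)`: `X_{iw}(x) = Jt(x) X_w(x)` (where `Jt(x)² = -1`).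
[cite: Wendl2020, App. B, §B.2.3] -/
theorem frame_I_mul {x : ℂ × ℂ} (hJ2 : ∀ v, Jt x (Jt x v) = -v) (w : ℂ) :
    frame Jt x (I * w) = Jt x (frame Jt x w) := by
  rw [frame_apply, frame_apply, map_add, map_smul, map_smul, hJ2]
  simp only [mul_re, I_re, zero_mul, I_im, one_mul, zero_sub, mul_im, neg_smul, smul_neg]
  abel

/-- The partial derivative `∂_q` of `x ↦ Jt(x) e₂`, as a real-linear map of the increment:
`D₁ x c = (DJt(x)(c,0)) e₂`. [folklore] -/
def D₁ (x : ℂ × ℂ) : ℂ →L[ℝ] ℂ × ℂ :=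
  (ContinuousLinearMap.apply ℝ (ℂ × ℂ) (((0 : ℂ), (1 : ℂ)) : ℂ × ℂ)).comp
    ((fderiv ℝ Jt x).comp (ContinuousLinearMap.inl ℝ ℂ ℂ))

/-- Unfolding `D₁`. [folklore] -/
theorem D₁_apply (x : ℂ × ℂ) (c : ℂ) : D₁ Jt x c = (fderiv ℝ Jt x (c, 0)) (0, 1) := rfl

variable {Jt}

/-- `x ↦ X_·(x)` is as smooth as `Jt`. [folklore] -/
theorem contDiffOn_frame {V : Set (ℂ × ℂ)} {n : WithTop ℕ∞} (hJ : ContDiffOn ℝ n Jt V) :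
    ContDiffOn ℝ n (frame Jt) V := by
  have h1 : ContDiffOn ℝ n (fun x => Jt x (((0 : ℂ), (1 : ℂ)) : ℂ × ℂ)) V :=
    hJ.clm_apply contDiffOn_const
  have h2 : ContDiffOn ℝ n (fun x => (imCLM : ℂ →L[ℝ] ℝ).smulRight (Jt x (0, 1))) V := by
    have : (fun x => (imCLM : ℂ →L[ℝ] ℝ).smulRight (Jt x (0, 1))) =
        fun x => (ContinuousLinearMap.smulRightL ℝ ℂ (ℂ × ℂ) (imCLM : ℂ →L[ℝ] ℝ)) (Jt x (0, 1)) := by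
      funext x; rfl
    rw [this]
    exact (ContinuousLinearMap.smulRightL ℝ ℂ (ℂ × ℂ) imCLM).contDiff.comp_contDiffOn h1
  exact contDiffOn_const.add h2

/-- `D₁` is `C¹` where `Jt` is smooth. [folklore] -/
theorem contDiffOn_D₁ {V : Set (ℂ × ℂ)} (hV : IsOpen V) (hJ : ContDiffOn ℝ ∞ Jt V) :
    ContDiffOn ℝ 1 (D₁ Jt) V := by
  have hD : ContDiffOn ℝ 1 (fderiv ℝ Jt) V := hJ.fderiv_of_isOpen (m := 1) hV (by norm_cast)
  have h1 : ContDiffOn ℝ 1 (fun x => (fderiv ℝ Jt x).comp (ContinuousLinearMap.inl ℝ ℂ ℂ)) V :=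
    hD.clm_comp contDiffOn_const
  exact contDiffOn_const.clm_comp h1

/-- The `q`-derivative of `q ↦ X_w(q,p)` is `Im w • D₁(q,p)`. [folklore] -/
theorem hasFDerivAt_frame_fst {V : Set (ℂ × ℂ)} (hV : IsOpen V) (hJ : ContDiffOn ℝ ∞ Jt V)
    {x : ℂ × ℂ} (hx : x ∈ V) (w : ℂ) :
    HasFDerivAt (fun q : ℂ => frame Jt (q, x.2) w) (w.im • D₁ Jt x) x.1 := by
  have hJd : DifferentiableAt ℝ Jt x :=
    (hJ.differentiableOn (by simp)).differentiableAt (hV.mem_nhds hx)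
  have hemb : HasFDerivAt (fun q : ℂ => ((q, x.2) : ℂ × ℂ)) (ContinuousLinearMap.inl ℝ ℂ ℂ) x.1 :=
    hasFDerivAt_prodMk_left (𝕜 := ℝ) x.1 x.2
  have h1 : HasFDerivAt (fun q : ℂ => Jt (q, x.2)) ((fderiv ℝ Jt x).comp (ContinuousLinearMap.inl ℝ ℂ ℂ))
      x.1 := by
    have := hJd.hasFDerivAt.comp x.1 hemb
    exact this
  have h2 : HasFDerivAt (fun q : ℂ => Jt (q, x.2) (((0 : ℂ), (1 : ℂ)) : ℂ × ℂ)) (D₁ Jt x) x.1 := by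
    have := (ContinuousLinearMap.apply ℝ (ℂ × ℂ) (((0 : ℂ), (1 : ℂ)) : ℂ × ℂ)).hasFDerivAt.comp
      x.1 h1
    exact this
  have h3 : HasFDerivAt (fun q : ℂ => w.im • Jt (q, x.2) (((0 : ℂ), (1 : ℂ)) : ℂ × ℂ))
      (w.im • D₁ Jt x) x.1 := h2.const_smul w.im
  have h4 := (hasFDerivAt_const (w.re • (((0 : ℂ), (1 : ℂ)) : ℂ × ℂ)) x.1).add h3
  simp only [zero_add] at h4
  refine h4.congr_of_eventuallyEq (Eventually.of_forall fun q => ?_)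
  simp [frame_apply]

/-- Along the axis `D₁` vanishes: `q ↦ Jt(q,0) e₂ = (0,i)` is constant. [folklore] -/
theorem D₁_axis {V : Set (ℂ × ℂ)} (hV : IsOpen V) (hJ : ContDiffOn ℝ ∞ Jt V) {r : ℝ}
    (haxis : ∀ q : ℂ, ‖q‖ < r → ((q, (0 : ℂ)) : ℂ × ℂ) ∈ V ∧ Jt (q, 0) (0, 1) = (0, I))
    {q : ℂ} (hq : ‖q‖ < r) : D₁ Jt (q, 0) = 0 := by
  have h1 : HasFDerivAt (fun q' : ℂ => Jt (q', (0 : ℂ)) (((0 : ℂ), (1 : ℂ)) : ℂ × ℂ)) (D₁ Jt (q, 0)) q := by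
    have h := hasFDerivAt_frame_fst hV hJ (haxis q hq).1 I
    have h' : HasFDerivAt (fun q' : ℂ => frame Jt (q', (0 : ℂ)) I -
        (I.re • (((0 : ℂ), (1 : ℂ)) : ℂ × ℂ))) (I.im • D₁ Jt (q, 0)) q := h.sub_const _
    simp only [I_im, one_smul] at h'
    refine h'.congr_of_eventuallyEq (Eventually.of_forall fun q' => ?_)
    simp [frame_apply]
  have h2 : HasFDerivAt (fun q' : ℂ => Jt (q', (0 : ℂ)) (((0 : ℂ), (1 : ℂ)) : ℂ × ℂ))
      (0 : ℂ →L[ℝ] ℂ × ℂ) q := by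
    have hc : ∀ᶠ q' in 𝓝 q, Jt (q', (0 : ℂ)) (((0 : ℂ), (1 : ℂ)) : ℂ × ℂ) = (0, I) := by
      have ho : IsOpen {q' : ℂ | ‖q'‖ < r} := isOpen_lt continuous_norm continuous_const
      filter_upwards [ho.mem_nhds hq] with q' hq' using (haxis q' hq').2
    exact (hasFDerivAt_const ((0 : ℂ), I) q).congr_of_eventuallyEq hc
  exact h1.unique h2

/-- **Lemma B.32** (Wendl 2020) together with the Lipschitz bound for the frame. For `Jt` smooth on
an open `V ∋ 0`, standard on normal vectors at axis points (`Jt(q,0)e₂ = (0,i)`, `|q| < r`): there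
are `C ≥ 0` and `δ > 0` with `B̄(0,δ) ⊆ V` such that for `x = (q,p), x' ∈ B̄(0,δ)` and `w ∈ ℂ`

* `‖X_w(x) - (0,w)‖ ≤ C |p| |w|`  (hence `|X̌_w(q,p)| ≤ C|p||w|` and `|X̂_w(q,p) - w| ≤ C|p||w|`),
* `‖∂_q X_w(q,p)‖ ≤ C |p| |w|`,
* `‖X_w(x) - X_w(x')‖ ≤ C ‖x - x'‖ |w|`.
[cite: Wendl2020, App. B, Lemma B.32] -/
theorem exists_frame_estimates {V : Set (ℂ × ℂ)} (hV : IsOpen V) (h0 : (0 : ℂ × ℂ) ∈ V)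
    (hJ : ContDiffOn ℝ ∞ Jt V) {r : ℝ} (hr : 0 < r)
    (haxis : ∀ q : ℂ, ‖q‖ < r → ((q, (0 : ℂ)) : ℂ × ℂ) ∈ V ∧ Jt (q, 0) (0, 1) = (0, I)) :
    ∃ (C δ : ℝ), 0 ≤ C ∧ 0 < δ ∧ δ < r ∧ closedBall (0 : ℂ × ℂ) δ ⊆ V ∧
      (∀ x ∈ closedBall (0 : ℂ × ℂ) δ, ∀ w : ℂ, ‖frame Jt x w - (0, w)‖ ≤ C * ‖x.2‖ * ‖w‖) ∧
      (∀ x ∈ closedBall (0 : ℂ × ℂ) δ, ∀ w : ℂ,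
        HasFDerivAt (fun q : ℂ => frame Jt (q, x.2) w) (w.im • D₁ Jt x) x.1 ∧
          ‖w.im • D₁ Jt x‖ ≤ C * ‖x.2‖ * ‖w‖) ∧
      (∀ x ∈ closedBall (0 : ℂ × ℂ) δ, ∀ x' ∈ closedBall (0 : ℂ × ℂ) δ, ∀ w : ℂ,
        ‖frame Jt x w - frame Jt x' w‖ ≤ C * ‖x - x'‖ * ‖w‖) := by
  -- a closed ball inside `V` and inside the axis strip
  obtain ⟨δ₀, hδ₀, hδ₀V⟩ := Metric.isOpen_iff.1 hV 0 h0
  set δ : ℝ := min (δ₀ / 2) (r / 2) with hδ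
  have hδpos : 0 < δ := lt_min (by positivity) (by positivity)
  have hδr : δ < r := (min_le_right _ _).trans_lt (by linarith)
  have hKV : closedBall (0 : ℂ × ℂ) δ ⊆ V :=
    (closedBall_subset_ball ((min_le_left _ _).trans_lt (by linarith))).trans hδ₀V
  have hKc : IsCompact (closedBall (0 : ℂ × ℂ) δ) := isCompact_closedBall 0 δ
  have hKconv : Convex ℝ (closedBall (0 : ℂ × ℂ) δ) := convex_closedBall 0 δ
  -- Lipschitz constants of `Jt` and `D₁` on the ball
  obtain ⟨K₁, hK₁⟩ := (hJ.mono hKV).exists_lipschitzOnWith (by simp) hKconv hKc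
  obtain ⟨K₂, hK₂⟩ := ((contDiffOn_D₁ hV hJ).mono hKV).exists_lipschitzOnWith one_ne_zero hKconv hKc
  -- axis points of the ball
  have haxK : ∀ x ∈ closedBall (0 : ℂ × ℂ) δ, ((x.1, 0) : ℂ × ℂ) ∈ closedBall (0 : ℂ × ℂ) δ ∧
      ‖x.1‖ < r := by
    intro x hx
    rw [mem_closedBall, dist_zero_right] at hx
    have h1 : ‖x.1‖ ≤ ‖x‖ := norm_fst_le x
    refine ⟨?_, by linarith⟩
    rw [mem_closedBall, dist_zero_right, Prod.norm_mk, norm_zero, max_eq_left (norm_nonneg _)]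
    exact h1.trans hx
  have hdist : ∀ x : ℂ × ℂ, ‖x - (x.1, 0)‖ = ‖x.2‖ := fun x => by
    obtain ⟨q, p⟩ := x
    simp [Prod.norm_def]
  refine ⟨max K₁ K₂, δ, by positivity, hδpos, hδr, hKV, ?_, ?_, ?_⟩
  · -- `‖X_w(x) - (0,w)‖ ≤ C |p| |w|`
    intro x hx w
    obtain ⟨hx0, hxr⟩ := haxK x hx
    have hax : frame Jt (x.1, 0) w = (0, w) := frame_axis Jt (haxis x.1 hxr).2 w
    have hdiff : frame Jt x w - (0, w) = w.im • (Jt x - Jt (x.1, 0)) (0, 1) := by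
      rw [← hax, frame_apply, frame_apply, show (Jt x - Jt (x.1, 0)) (0, 1) = Jt x (0, 1) - Jt (x.1, 0) (0, 1)
        from rfl, smul_sub]; abel
    have hL : ‖Jt x - Jt (x.1, 0)‖ ≤ K₁ * ‖x.2‖ := by
      rw [← dist_eq_norm, ← hdist x, ← dist_eq_norm]; exact hK₁.dist_le_mul x hx _ hx0
    rw [hdiff, norm_smul]
    calc ‖w.im‖ * ‖(Jt x - Jt (x.1, 0)) (0, 1)‖
        ≤ ‖w‖ * (‖Jt x - Jt (x.1, 0)‖ * ‖(((0 : ℂ), (1 : ℂ)) : ℂ × ℂ)‖) := by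
          gcongr
          · exact abs_im_le_norm w
          · exact ContinuousLinearMap.le_opNorm _ _
      _ ≤ ‖w‖ * (K₁ * ‖x.2‖ * 1) := by
          gcongr
          simp [Prod.norm_def]
      _ ≤ ‖w‖ * (((max K₁ K₂ : NNReal) : ℝ) * ‖x.2‖ * 1) := by
          gcongr; exact_mod_cast le_max_left K₁ K₂
      _ = ((max K₁ K₂ : NNReal) : ℝ) * ‖x.2‖ * ‖w‖ := by ring
  · -- the `q`-derivative
    intro x hx w
    obtain ⟨hx0, hxr⟩ := haxK x hx
    refine ⟨hasFDerivAt_frame_fst hV hJ (hKV hx) w, ?_⟩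
    have hD0 : D₁ Jt (x.1, 0) = 0 := D₁_axis hV hJ haxis hxr
    have hL : ‖D₁ Jt x‖ ≤ K₂ * ‖x.2‖ := by
      have := hK₂.dist_le_mul x hx _ hx0
      rwa [hD0, dist_zero_right, dist_eq_norm, hdist x] at this
    rw [norm_smul]
    calc ‖w.im‖ * ‖D₁ Jt x‖ ≤ ‖w‖ * (K₂ * ‖x.2‖) := by
          gcongr; exact abs_im_le_norm w
      _ ≤ ‖w‖ * (((max K₁ K₂ : NNReal) : ℝ) * ‖x.2‖) := by
          gcongr; exact_mod_cast le_max_right K₁ K₂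
      _ = ((max K₁ K₂ : NNReal) : ℝ) * ‖x.2‖ * ‖w‖ := by ring
  · -- Lipschitz in `x`
    intro x hx x' hx' w
    have hdiff : frame Jt x w - frame Jt x' w = w.im • (Jt x - Jt x') (0, 1) := by
      rw [frame_apply, frame_apply, show (Jt x - Jt x') (0, 1) = Jt x (0, 1) - Jt x' (0, 1) from rfl,
        smul_sub]; abel
    have hL : ‖Jt x - Jt x'‖ ≤ K₁ * ‖x - x'‖ := by
      rw [← dist_eq_norm, ← dist_eq_norm]; exact hK₁.dist_le_mul x hx x' hx'
    rw [hdiff, norm_smul]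
    calc ‖w.im‖ * ‖(Jt x - Jt x') (0, 1)‖
        ≤ ‖w‖ * (‖Jt x - Jt x'‖ * ‖(((0 : ℂ), (1 : ℂ)) : ℂ × ℂ)‖) := by
          gcongr
          · exact abs_im_le_norm w
          · exact ContinuousLinearMap.le_opNorm _ _
      _ ≤ ‖w‖ * (K₁ * ‖x - x'‖ * 1) := by
          gcongr
          simp [Prod.norm_def]
      _ ≤ ‖w‖ * (((max K₁ K₂ : NNReal) : ℝ) * ‖x - x'‖ * 1) := by
          gcongr; exact_mod_cast le_max_left K₁ K₂
      _ = ((max K₁ K₂ : NNReal) : ℝ) * ‖x - x'‖ * ‖w‖ := by ring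

end Literature.Geometry.Symplectic.NormalPushoff

end
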